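import Mathlib.Analysis.Calculus.ContDiff.Operations
import Mathlib.Analysis.Calculus.FDeriv.Mul
import Mathlib.Analysis.Normed.Ring.Units
import Mathlib.Analysis.Complex.Basic
import Mathlib.Topology.MetricSpace.ProperSpace
import HarnessLib

/-!
# The frame reduction of a linear Cauchy–Riemann type equation to the `∂̄`-inequality

The standard device by which statements about solutions `w₀ : ℂ → G` of a LINEAR first-order
equation of Cauchy–Riemann type with a varying complex structure,

  `∂_y w₀ = Jt z (∂ₓ w₀) + A z (w₀ z)`,   `(Jt z)² = -1`,  `Jt z₀ = i`,

are reduced to the `∂̄`-inequality `‖∂ₓ w + i ∂_y w‖ ≤ C ‖w‖` for the standard complex structure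
(McDuff–Salamon (2012), proof of Lemma 2.4.1 / §2.3; Wendl (2020), App. B, proof of Thm B.20,
"choose a complex trivialization"; in the tree already used inline in
`JHolomorphicUniqueContinuationFlat.lean` and `JHolomorphicCriticalPointsIsolated.lean`): with
`J₀ = Jt z₀ = i` the FRAME `Φ z = ½ (1 - Jt z ∘ J₀)` satisfies `Jt z ∘ Φ z = Φ z ∘ J₀` and
`Φ z₀ = 1`, so it is invertible near `z₀` with smooth inverse `Ψ`, and `w = Ψ w₀` satisfies
`∂_y w - i ∂ₓ w = Ψ (Jt (∂ₓΦ) w + A Φ w - (∂_yΦ) w)`, whence the inequality on a disc about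
`z₀`, together with the two-sided comparison `‖w‖ ≍ ‖w₀‖`.

* `FrameReduction.exists_frame` — the statement above for maps into a complex Banach space `G`
  (the complex structure at the base point being literally `v ↦ i • v`).

Typical instances: `w₀ = u - u z₀` for a `J`-holomorphic `u` (`A = 0`; order of vanishing and
leading term, `JHolomorphicCriticalOrder.lean`), `w₀ = ∂ₓ u` (`A = ∂ₓ(J ∘ u)`; isolated critical
points), differences and normal components of pairs of `J`-curves.

## References

* D. McDuff, D. Salamon, *J-holomorphic curves and symplectic topology*, 2nd ed. (2012), §2.3,
  Lemma 2.4.1. [McDuffSalamon2012]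
* C. Wendl, *Lectures on Contact 3-Manifolds, Holomorphic Curves and Intersection Theory* (2020),
  App. B, Thm B.20. [Wendl2020]
-/

noncomputable section

open scoped ContDiff Topology
open Set Filter Metric Function Complex

namespace Literature.Geometry.Symplectic

namespace FrameReduction

variable {G : Type*} [NormedAddCommGroup G] [NormedSpace ℂ G] [CompleteSpace G]

/-- **Frame reduction.** Let `Jt`, `w₀` be smooth and `A` continuous on a neighbourhood `U` of
`z₀`, with `(Jt z)² = -1` on `U`, `Jt z₀ = i` and `∂_y w₀ = Jt ∂ₓ w₀ + A w₀` on `U`. Then on some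
disc `B(z₀, R) ⊆ U` there are smooth mutually inverse operator fields `Φ`, `Ψ` with `Φ z₀ = 1`
such that `w = Ψ w₀` satisfies `‖∂ₓ w + i ∂_y w‖ ≤ C ‖w‖`, and `‖w‖ ≤ M ‖w₀‖`, `‖w₀‖ ≤ M ‖w‖`
pointwise on the disc. [cite: McDuffSalamon2012, §2.3 and Lemma 2.4.1 (proof)] -/
theorem exists_frame {Jt : ℂ → G →L[ℝ] G} {w₀ : ℂ → G} {A : ℂ → G →L[ℝ] G} {z₀ : ℂ}
    {U : Set ℂ} (hU : U ∈ 𝓝 z₀) (hJt : ContDiffOn ℝ ∞ Jt U)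
    (hJ2 : ∀ z ∈ U, ∀ v, Jt z (Jt z v) = -v) (hJ0 : ∀ v, Jt z₀ v = I • v)
    (hw₀ : ContDiffOn ℝ ∞ w₀ U) (hA : ContinuousOn A U)
    (heq : ∀ z ∈ U, fderiv ℝ w₀ z I = Jt z (fderiv ℝ w₀ z 1) + A z (w₀ z)) :
    ∃ (R C M : ℝ) (Φ Ψ : ℂ → G →L[ℝ] G), 0 < R ∧ 0 ≤ C ∧ 0 ≤ M ∧ ball z₀ R ⊆ U ∧
      ContDiffOn ℝ ∞ Φ (ball z₀ R) ∧ ContDiffOn ℝ ∞ Ψ (ball z₀ R) ∧ Φ z₀ = 1 ∧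
      (∀ z ∈ ball z₀ R, ∀ x, Ψ z (Φ z x) = x) ∧ (∀ z ∈ ball z₀ R, ∀ x, Φ z (Ψ z x) = x) ∧
      (∀ z ∈ ball z₀ R, ∀ x, Jt z (Φ z x) = Φ z (I • x)) ∧
      ContDiffOn ℝ ∞ (fun z => Ψ z (w₀ z)) (ball z₀ R) ∧
      (∀ z ∈ ball z₀ R, ‖fderiv ℝ (fun y => Ψ y (w₀ y)) z 1 +
          I • fderiv ℝ (fun y => Ψ y (w₀ y)) z I‖ ≤ C * ‖Ψ z (w₀ z)‖) ∧
      (∀ z ∈ ball z₀ R, ‖Ψ z (w₀ z)‖ ≤ M * ‖w₀ z‖ ∧ ‖w₀ z‖ ≤ M * ‖Ψ z (w₀ z)‖) := by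
  -- an open neighbourhood `U' ⊆ U` of `z₀`
  obtain ⟨U', hU'U, hU'open, hz₀U'⟩ := _root_.mem_nhds_iff.mp hU
  have hz₀U : z₀ ∈ U := hU'U hz₀U'
  have hJtU' : ContDiffOn ℝ ∞ Jt U' := hJt.mono hU'U
  have hw₀U' : ContDiffOn ℝ ∞ w₀ U' := hw₀.mono hU'U
  -- the base structure `J₀ = i` and the frame `Φ = ½(1 - Jt J₀)`
  set J₀ : G →L[ℝ] G := Jt z₀ with hJ₀
  have hJ₀2 : ∀ v, J₀ (J₀ v) = -v := hJ2 z₀ hz₀U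
  obtain ⟨Φ, hΦ_def⟩ : ∃ Φ : ℂ → G →L[ℝ] G, Φ = fun z => (1 / 2 : ℝ) • (1 - Jt z * J₀) :=
    ⟨_, rfl⟩
  have hΦU' : ContDiffOn ℝ ∞ Φ U' := by
    rw [hΦ_def]
    exact (contDiffOn_const.sub (hJtU'.mul contDiffOn_const)).const_smul (1 / 2 : ℝ)
  have hΦz₀ : Φ z₀ = 1 := by
    rw [hΦ_def]
    ext x
    show (1 / 2 : ℝ) • (x - J₀ (J₀ x)) = x
    rw [hJ₀2, sub_neg_eq_add, ← two_smul ℝ x, smul_smul]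
    norm_num
  have hcomm : ∀ z ∈ U', ∀ x, Jt z (Φ z x) = Φ z (J₀ x) := fun z hz x => by
    rw [hΦ_def]
    show Jt z ((1 / 2 : ℝ) • (x - Jt z (J₀ x))) = (1 / 2 : ℝ) • (J₀ x - Jt z (J₀ (J₀ x)))
    rw [map_smul, map_sub, hJ2 z (hU'U hz), hJ₀2, map_neg]
    congr 1
    abel
  -- the open set `V ⊆ U'` where `Φ` is invertible, and the inverse frame `Ψ`
  set V : Set ℂ := U' ∩ Φ ⁻¹' {x | IsUnit x} with hV
  have hVopen : IsOpen V := hΦU'.continuousOn.isOpen_inter_preimage hU'open Units.isOpen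
  have hz₀V : z₀ ∈ V := ⟨hz₀U', by simp [hΦz₀]⟩
  have hVU' : V ⊆ U' := fun z hz => hz.1
  have hVnhds : ∀ z ∈ V, V ∈ 𝓝 z := fun z hz => hVopen.mem_nhds hz
  obtain ⟨Ψ, hΨ_def⟩ : ∃ Ψ : ℂ → G →L[ℝ] G, Ψ = fun z => Ring.inverse (Φ z) := ⟨_, rfl⟩
  have hΨΦ : ∀ z ∈ V, ∀ x, Ψ z (Φ z x) = x := by
    intro z hz x
    rw [hΨ_def]
    show (Ring.inverse (Φ z) * Φ z) x = x
    rw [Ring.inverse_mul_cancel _ hz.2]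
    rfl
  have hΦΨ : ∀ z ∈ V, ∀ x, Φ z (Ψ z x) = x := by
    intro z hz x
    rw [hΨ_def]
    show (Φ z * Ring.inverse (Φ z)) x = x
    rw [Ring.mul_inverse_cancel _ hz.2]
    rfl
  have hΨV : ContDiffOn ℝ ∞ Ψ V := by
    intro z hz
    obtain ⟨uΦ, huΦ⟩ := hz.2
    have h1 : ContDiffAt ℝ ∞ Ring.inverse (Φ z) := by
      rw [← huΦ]; exact contDiffAt_ringInverse ℝ uΦ
    rw [hΨ_def]
    exact h1.comp_contDiffWithinAt z ((hΦU' z hz.1).mono hVU')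
  -- a ball `ball z₀ R₀ ⊆ V` and the working radius `R = R₀ / 2`
  obtain ⟨R₀, hR₀, hballV⟩ := Metric.isOpen_iff.mp hVopen z₀ hz₀V
  set R : ℝ := R₀ / 2 with hR
  have hRpos : 0 < R := by positivity
  have hcbV : closedBall z₀ R ⊆ V := fun z hz =>
    hballV (mem_ball.mpr (lt_of_le_of_lt (mem_closedBall.mp hz) (by rw [hR]; linarith)))
  have hbV : ball z₀ R ⊆ V := ball_subset_closedBall.trans hcbV
  -- the function `w = Ψ w₀`
  obtain ⟨w, hw_def⟩ : ∃ w : ℂ → G, w = fun z => Ψ z (w₀ z) := ⟨_, rfl⟩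
  have hwV : ContDiffOn ℝ ∞ w V := by
    rw [hw_def]; exact hΨV.clm_apply (hw₀U'.mono hVU')
  have hw₀w : ∀ z ∈ V, w₀ z = Φ z (w z) := fun z hz => by rw [hw_def, hΦΨ z hz]
  -- derivatives on `V`
  have hw₀d : ∀ z ∈ V, HasFDerivAt w₀ (fderiv ℝ w₀ z) z := fun z hz =>
    (((hw₀U'.mono hVU').contDiffAt (hVnhds z hz)).differentiableAt (by simp)).hasFDerivAt
  have hwd : ∀ z ∈ V, HasFDerivAt w (fderiv ℝ w z) z := fun z hz =>
    ((hwV.contDiffAt (hVnhds z hz)).differentiableAt (by simp)).hasFDerivAt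
  have hΦd : ∀ z ∈ V, HasFDerivAt Φ (fderiv ℝ Φ z) z := fun z hz =>
    (((hΦU'.mono hVU').contDiffAt (hVnhds z hz)).differentiableAt (by simp)).hasFDerivAt
  have hDw₀ : ∀ z ∈ V, ∀ ζ, fderiv ℝ w₀ z ζ = Φ z (fderiv ℝ w z ζ) + fderiv ℝ Φ z ζ (w z) := by
    intro z hz ζ
    have h2 : HasFDerivAt (fun y => Φ y (w y))
        ((Φ z).comp (fderiv ℝ w z) + (fderiv ℝ Φ z).flip (w z)) z :=
      (hΦd z hz).clm_apply (hwd z hz)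
    have hev : w₀ =ᶠ[𝓝 z] fun y => Φ y (w y) := by
      filter_upwards [hVnhds z hz] with y hy using hw₀w y hy
    have h3 := (hw₀d z hz).unique (h2.congr_of_eventuallyEq hev)
    rw [h3]
    simp
  -- the key identity `∂_y w - J₀ ∂ₓ w = Ψ (Jt (∂ₓΦ) w + A (Φ w) - (∂_yΦ) w)` on `V`
  have hkey : ∀ z ∈ V, fderiv ℝ w z I - J₀ (fderiv ℝ w z 1) =
      Ψ z (Jt z (fderiv ℝ Φ z 1 (w z)) + A z (Φ z (w z)) - fderiv ℝ Φ z I (w z)) := by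
    intro z hz
    have hzU' : z ∈ U' := hVU' hz
    have h := heq z (hU'U hzU')
    rw [hDw₀ z hz I, hDw₀ z hz 1, map_add, hcomm z hzU', hw₀w z hz] at h
    have h' : Φ z (fderiv ℝ w z I - J₀ (fderiv ℝ w z 1)) =
        Jt z (fderiv ℝ Φ z 1 (w z)) + A z (Φ z (w z)) - fderiv ℝ Φ z I (w z) := by
      rw [map_sub]
      exact sub_eq_sub_iff_add_eq_add.mpr (by rw [h]; abel)
    calc fderiv ℝ w z I - J₀ (fderiv ℝ w z 1)
        = Ψ z (Φ z (fderiv ℝ w z I - J₀ (fderiv ℝ w z 1))) := (hΨΦ z hz _).symm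
      _ = _ := by rw [h']
  -- sup bounds on the closed disc `closedBall z₀ R ⊆ V`
  have hK : IsCompact (closedBall z₀ R) := isCompact_closedBall _ _
  have hΨcont : ContinuousOn Ψ (closedBall z₀ R) := hΨV.continuousOn.mono hcbV
  have hΦcont : ContinuousOn Φ (closedBall z₀ R) := hΦU'.continuousOn.mono (hcbV.trans hVU')
  have hJcont : ContinuousOn Jt (closedBall z₀ R) := hJtU'.continuousOn.mono (hcbV.trans hVU')
  have hAcont : ContinuousOn A (closedBall z₀ R) := hA.mono ((hcbV.trans hVU').trans hU'U)
  have hDΦcont : ContinuousOn (fderiv ℝ Φ) (closedBall z₀ R) :=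
    ((hΦU'.mono hVU').continuousOn_fderiv_of_isOpen hVopen (by simp)).mono hcbV
  obtain ⟨MΨ, hMΨ⟩ := hK.exists_bound_of_continuousOn hΨcont
  obtain ⟨MΦ₀, hMΦ₀⟩ := hK.exists_bound_of_continuousOn hΦcont
  obtain ⟨MJ, hMJ⟩ := hK.exists_bound_of_continuousOn hJcont
  obtain ⟨MA, hMA⟩ := hK.exists_bound_of_continuousOn hAcont
  obtain ⟨MΦ, hMΦ⟩ := hK.exists_bound_of_continuousOn (f := fderiv ℝ Φ) hDΦcont
  have hz₀K : z₀ ∈ closedBall z₀ R := mem_closedBall_self hRpos.le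
  have hMΨnn : 0 ≤ MΨ := (norm_nonneg _).trans (hMΨ z₀ hz₀K)
  have hMΦ₀nn : 0 ≤ MΦ₀ := (norm_nonneg _).trans (hMΦ₀ z₀ hz₀K)
  have hMJnn : 0 ≤ MJ := (norm_nonneg _).trans (hMJ z₀ hz₀K)
  have hMAnn : 0 ≤ MA := (norm_nonneg _).trans (hMA z₀ hz₀K)
  have hMΦnn : 0 ≤ MΦ := (norm_nonneg _).trans (hMΦ z₀ hz₀K)
  obtain ⟨C, hC⟩ : ∃ C : ℝ, C = MΨ * (MJ * MΦ + MA * MΦ₀ + MΦ) := ⟨_, rfl⟩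
  have hCnn : 0 ≤ C := by rw [hC]; positivity
  have hineq : ∀ z ∈ ball z₀ R, ‖fderiv ℝ w z 1 + I • fderiv ℝ w z I‖ ≤ C * ‖w z‖ := by
    intro z hz
    have hzK : z ∈ closedBall z₀ R := ball_subset_closedBall hz
    have hzV : z ∈ V := hbV hz
    have hid : fderiv ℝ w z 1 + I • fderiv ℝ w z I = I • (fderiv ℝ w z I - J₀ (fderiv ℝ w z 1)) := by
      rw [smul_sub, show J₀ (fderiv ℝ w z 1) = I • fderiv ℝ w z 1 from hJ0 _, smul_smul,
        Complex.I_mul_I, neg_one_smul]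
      abel
    rw [hid, norm_smul, Complex.norm_I, one_mul, hkey z hzV]
    have hΦe : ∀ e : ℂ, ‖e‖ = 1 → ‖fderiv ℝ Φ z e (w z)‖ ≤ MΦ * ‖w z‖ := by
      intro e he
      calc ‖fderiv ℝ Φ z e (w z)‖ ≤ ‖fderiv ℝ Φ z e‖ * ‖w z‖ :=
            ContinuousLinearMap.le_opNorm _ _
        _ ≤ (‖fderiv ℝ Φ z‖ * ‖e‖) * ‖w z‖ := by
            gcongr; exact ContinuousLinearMap.le_opNorm _ _
        _ ≤ MΦ * ‖w z‖ := by rw [he, mul_one]; gcongr; exact hMΦ z hzK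
    have h1 := hΦe 1 norm_one
    have h2 := hΦe I Complex.norm_I
    have h3 : ‖Jt z (fderiv ℝ Φ z 1 (w z))‖ ≤ MJ * (MΦ * ‖w z‖) :=
      (ContinuousLinearMap.le_opNorm _ _).trans
        (mul_le_mul (hMJ z hzK) h1 (norm_nonneg _) hMJnn)
    have h4 : ‖A z (Φ z (w z))‖ ≤ MA * (MΦ₀ * ‖w z‖) := by
      calc ‖A z (Φ z (w z))‖ ≤ ‖A z‖ * ‖Φ z (w z)‖ := ContinuousLinearMap.le_opNorm _ _
        _ ≤ ‖A z‖ * (‖Φ z‖ * ‖w z‖) := by gcongr; exact ContinuousLinearMap.le_opNorm _ _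
        _ ≤ MA * (MΦ₀ * ‖w z‖) := by
            gcongr
            · exact hMA z hzK
            · exact hMΦ₀ z hzK
    have h5 : ‖Jt z (fderiv ℝ Φ z 1 (w z)) + A z (Φ z (w z)) - fderiv ℝ Φ z I (w z)‖ ≤
        (MJ * MΦ + MA * MΦ₀ + MΦ) * ‖w z‖ := by
      calc ‖Jt z (fderiv ℝ Φ z 1 (w z)) + A z (Φ z (w z)) - fderiv ℝ Φ z I (w z)‖
          ≤ ‖Jt z (fderiv ℝ Φ z 1 (w z)) + A z (Φ z (w z))‖ + ‖fderiv ℝ Φ z I (w z)‖ :=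
            norm_sub_le _ _
        _ ≤ ‖Jt z (fderiv ℝ Φ z 1 (w z))‖ + ‖A z (Φ z (w z))‖ + ‖fderiv ℝ Φ z I (w z)‖ := by
            gcongr; exact norm_add_le _ _
        _ ≤ MJ * (MΦ * ‖w z‖) + MA * (MΦ₀ * ‖w z‖) + MΦ * ‖w z‖ :=
            add_le_add (add_le_add h3 h4) h2
        _ = (MJ * MΦ + MA * MΦ₀ + MΦ) * ‖w z‖ := by ring
    calc ‖Ψ z (Jt z (fderiv ℝ Φ z 1 (w z)) + A z (Φ z (w z)) - fderiv ℝ Φ z I (w z))‖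
        ≤ ‖Ψ z‖ * ‖Jt z (fderiv ℝ Φ z 1 (w z)) + A z (Φ z (w z)) - fderiv ℝ Φ z I (w z)‖ :=
          ContinuousLinearMap.le_opNorm _ _
      _ ≤ MΨ * ((MJ * MΦ + MA * MΦ₀ + MΦ) * ‖w z‖) :=
          mul_le_mul (hMΨ z hzK) h5 (norm_nonneg _) hMΨnn
      _ = C * ‖w z‖ := by rw [hC]; ring
  -- the two-sided comparison `‖w‖ ≤ M ‖w₀‖`, `‖w₀‖ ≤ M ‖w‖`
  have hcmp : ∀ z ∈ ball z₀ R, ‖w z‖ ≤ max MΨ MΦ₀ * ‖w₀ z‖ ∧ ‖w₀ z‖ ≤ max MΨ MΦ₀ * ‖w z‖ := by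
    intro z hz
    have hzK : z ∈ closedBall z₀ R := ball_subset_closedBall hz
    have hzV : z ∈ V := hbV hz
    constructor
    · calc ‖w z‖ = ‖Ψ z (w₀ z)‖ := by rw [hw_def]
        _ ≤ ‖Ψ z‖ * ‖w₀ z‖ := ContinuousLinearMap.le_opNorm _ _
        _ ≤ max MΨ MΦ₀ * ‖w₀ z‖ := by
            gcongr; exact (hMΨ z hzK).trans (le_max_left _ _)
    · calc ‖w₀ z‖ = ‖Φ z (w z)‖ := by rw [hw₀w z hzV]
        _ ≤ ‖Φ z‖ * ‖w z‖ := ContinuousLinearMap.le_opNorm _ _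
        _ ≤ max MΨ MΦ₀ * ‖w z‖ := by
            gcongr; exact (hMΦ₀ z hzK).trans (le_max_right _ _)
  refine ⟨R, C, max MΨ MΦ₀, Φ, Ψ, hRpos, hCnn, hMΨnn.trans (le_max_left _ _),
    hbV.trans (hVU'.trans hU'U), (hΦU'.mono hVU').mono hbV, hΨV.mono hbV, hΦz₀,
    fun z hz => hΨΦ z (hbV hz), fun z hz => hΦΨ z (hbV hz), fun z hz x => ?_, ?_,
    fun z hz => ?_, fun z hz => ?_⟩
  · rw [hcomm z (hVU' (hbV hz)), show J₀ x = I • x from hJ0 x]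
  · have h := hwV.mono hbV
    rwa [hw_def] at h
  · have h := hineq z hz
    rw [hw_def] at h
    exact h
  · have h := hcmp z hz
    rw [hw_def] at h
    exact h

end FrameReduction

end Literature.Geometry.Symplectic

end
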